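import Literature.NumberTheory.Automorphic.Liu2021.AppendixC.EtaleBettiComparison
import Literature.NumberTheory.Automorphic.Liu2021.AppendixC.RestOneLevelInvariantsHom
import HarnessLib

/-!
# [Liu 2021, §4.3 l. 2160] the Hecke action on `H¹_ét(A_∞ ⊗_E Ē, ℚ_ℓ)` INDUCED by the Hecke translates — the étale Hecke
# datum of a tower CONSTRUCTED, with its level compatibility from descent up to isogeny

Topic `NumberTheory/Automorphic/Liu2021/AppendixC`; namespace `Literature.NumberTheory.Automorphic.Liu2021.AppendixC`.
Continuation of `EtaleH1Tower.lean` (p592872: `C.etaleH1 ℓ K = (V_ℓ A_K)^∨`, the colimit `C.etaleH1Tower ℓ`, `C.toTower ℓ K`,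
`C.towerRep ℓ`, the POSITED structure `C.EtaleHeckeDatum ℓ`), of `EtaleBettiComparison.lean` (p595473: `EtaleHeckeDatum.IsInducedBy`)
and of `RestOneLevelInvariantsHom.lean` (`HeckeTranslates.IsogenyDescent`, row (D) of the cell hodgecm-mathlib).  This is the ÉTALE TWIN of
`RestOneHecke.lean` / `RestOneLevelInvariants.lean` (which do the same for `Ω = colim_K ℚ ⊗ Hom_E(A_K, B)`): everything there is
covariant in `Hom(A_K, ·)`, everything here is covariant in `Hom_{ℚ_ℓ}(V_ℓ A_K, ℚ_ℓ)`.

* §1 the étale direct system `K ↦ (V_ℓ A_K)^∨` is a DIRECTED system (`directedSystem_etSys`); every class of the colimit is a level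
  class (`exists_eq_toTower`).
* §2 **`HeckeTranslates.etHeckeRep T ℓ : Representation ℚ_[ℓ] C.G (C.etaleH1Tower ℓ)`** — the action «provided by the Hecke
  correspondences» (§4.2 l. 2074) on `H¹_ét(A_∞)` (§4.3 l. 2160), CONSTRUCTED from the translates `T` exactly as `RestOneHecke.heckeRep`:
  level components `[·]_{gKg⁻¹ ∩ K₀} ∘ ᵗV_ℓ(Alb(T_g))` (`etHeckeAux`), independent of the admissible source level (`toTower_dualMap_albTr`),
  compatible with the transition maps (`etHeckeAux_sys`), glued by `Module.DirectLimit.lift` (`etHecke`); defining formula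
  `etHeckeRep_toTower` (= `IsInducedBy T`), `etHeckeRep_toTower_of_mem` (`T_k = 𝟙`), commutation with the Galois action
  `etHeckeRep_towerRep` (`V_ℓ f` is `Γ_E`-equivariant), smoothness `exists_forall_etHeckeRep_eq`.
* §3 level compatibility: `toTower_injective` from injective pull-backs `ᵗV_ℓ(Alb_u)` (a directed colimit with injective transition
  maps), and **`exists_dualMap_eq_of_isogenyDescent`** — a `K`-invariant linear form on `V_ℓ(A_N)` (`N ⊴ K` small) is pulled back from
  `V_ℓ(A_K)`, from `IsogenyDescent` ALONE, applied to the NORM endomorphism `e = Σ_{q ∈ K/N} Alb(T_q)` of `A_N`: `Alb_u ≫ ψ = m • e`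
  gives `λ = ᵗV_ℓ(Alb_u) ((m·[K:N])⁻¹ • λ ∘ V_ℓ ψ)` for every invariant `λ` (so the étale side needs (D) but NOT (I)); whence
  `range_toTower_eq_of_isogenyDescent : range [·]_K = H¹_ét(A_∞)^K` at EVERY level.
* §4 **`HeckeTranslates.etaleHeckeDatumOfTranslates T ℓ hI hD : C.EtaleHeckeDatum ℓ`** and `isInducedBy_etaleHeckeDatumOfTranslates` —
  the posited structure of `EtaleH1Tower.lean` INHABITED from the translates, given injective étale pull-backs `hI` and `T.IsogenyDescent`.

Definitions with bodies and theorems only: NO named fact, NO instance, NO `sorry`; net Literature debt 0.  Consumer: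
`EtaleBettiComparisonHolds.lean` (the `_holds`-from-(D) of the named fact `Sec42Data.exists_etaleHeckeDatum_with_bettiComparison`, row
VI-2″ of the cell; a3_liu418 v4 stub `stub_etaleComparisonAtFace`).  HC_CM is proved only modulo the 7 printed citations until rung 0
closes; this file discharges none of them.

## References
* [Liu2021] Y. Liu, *Fourier–Jacobi cycles and arithmetic relative trace formula*, Camb. J. Math. 9 (2021) = arXiv:2102.11518
  (`FJcycle.tex`): §4.2 l. 2070–2074 (the projective system `{A_K}`, the Hecke homomorphism), §4.3 l. 2158–2160 (the colimit, «a
  `ℚ_ℓ^{ac}[Gal(ℂ/τ'(E)) × 𝔾(𝔸_F^∞)]`-module»), Thm. 4.18 (1) l. 2239 and its proof l. 2274–2282, Lem. 2.4 (1).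
* [Milne2005ShimuraVarieties] J. S. Milne, *Introduction to Shimura varieties* (2005), §5 p. 57 L7–12 / p. 58 L3–11 (`T(g)`, the
  level acts trivially), §13 p. 118 L21–28.
* [Milne1986AbelianVarieties] J. S. Milne, *Abelian varieties* (Cornell–Silverman 1986), Thm 15.1 (a) (`H¹_ét = (T_ℓ)^∨`).
* Tree: `AppendixC.EtaleH1Tower`, `AppendixC.EtaleBettiComparison`, `AppendixC.RestOneHecke` (the template),
  `AppendixC.RestOneLevelInvariants` (`exists_le_le`, `exists_normal_le`, `isDirectedOrder_idx`), `AppendixC.RestOneLevelInvariantsHom`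
  (`IsogenyDescent`), `Motives.TateAbelianFiniteSteps` (`rationalTateModuleMap_add/_comp/_id`, `rationalTateRep_rationalTateModuleMap`).
-/

set_option autoImplicit false

noncomputable section

open CategoryTheory NumberField
open scoped TensorProduct

namespace Literature.NumberTheory.Automorphic.Liu2021.AppendixC

open Literature.AlgebraicGeometry.Motives (AbelianVariety)
open Literature.AlgebraicGeometry.Motives.AbelianVariety (rationalTateModuleMap rationalTateModuleMap_id
  rationalTateModuleMap_comp rationalTateModuleMap_add rationalTateRep_rationalTateModuleMap)

variable {F E : Type} [Field F] [NumberField F] [IsTotallyReal F] [Field E] [NumberField E] [Algebra F E]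
  [IsTotallyComplex E] [Algebra.IsQuadraticExtension F E]
variable {P5 : PropC5Data F E} {isotropicAt : ℕ → Prop}

/-! ## §0 Contravariance of `ᵗV_ℓ` (bookkeeping) -/

/-- `ᵗV_ℓ(a) (ᵗV_ℓ(b) φ) = ᵗV_ℓ(a ≫ b) φ`: pull-back of linear forms on rational Tate modules is contravariantly functorial
(`rationalTateModuleMap_comp`, dualised). [cite: Milne1986AbelianVarieties, Thm 15.1 (a)] -/
theorem dualMap_rationalTateModuleMap_comp_apply {K : Type} [Field K] {X Y Z : AbelianVariety K} (ℓ : ℕ) [Fact ℓ.Prime]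
    (a : X ⟶ Y) (b : Y ⟶ Z) (φ : Module.Dual ℚ_[ℓ] (Z.rationalTateModule ℓ)) :
    (rationalTateModuleMap ℓ a).dualMap ((rationalTateModuleMap ℓ b).dualMap φ) =
      (rationalTateModuleMap ℓ (a ≫ b)).dualMap φ := by
  rw [rationalTateModuleMap_comp]
  rfl

/-! ## §1 The étale direct system is directed; every class lives at one level -/

namespace Sec42Data

variable (C : Sec42Data P5 isotropicAt) (ℓ : ℕ) [Fact ℓ.Prime]

open RestOne (Idx)
open scoped Classical

/-- The étale direct system `K ↦ (V_ℓ A_K)^∨`, `(K' ⊆ K) ↦ ᵗV_ℓ(Alb_{u^{K'}_K})`, is a directed system (functoriality of `{A_K}_K`,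
`Atr_id` / `Atr_comp`, and of `V_ℓ`). [cite: Liu2021, §4.2 (FJcycle.tex l. 2070–2072) and §4.3 (l. 2158)] -/
theorem directedSystem_etSys : DirectedSystem (C.etSysObj ℓ) (C.etSys ℓ · · ·) where
  map_self i φ := by
    show (rationalTateModuleMap ℓ (C.Atr (homOfLE _))).dualMap φ = φ
    have hid : (homOfLE (le_refl (OrderDual.ofDual i)) : OrderDual.ofDual i ⟶ OrderDual.ofDual i) = 𝟙 _ := rfl
    rw [hid, C.Atr_id, rationalTateModuleMap_id, LinearMap.dualMap_id, LinearMap.id_apply]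
  map_map {i j k} hij hjk φ := by
    show (rationalTateModuleMap ℓ (C.Atr (homOfLE _))).dualMap
        ((rationalTateModuleMap ℓ (C.Atr (homOfLE _))).dualMap φ) =
      (rationalTateModuleMap ℓ (C.Atr (homOfLE _))).dualMap φ
    rw [dualMap_rationalTateModuleMap_comp_apply, ← C.Atr_comp]
    rfl

/-- Every class of `H¹_ét(A_∞)` is a level class `[φ]_K` (the colimit is directed and the index is inhabited by `K₀`).
[cite: Liu2021, §4.3 (FJcycle.tex l. 2158)] -/
theorem exists_eq_toTower (x : C.etaleH1Tower ℓ) :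
    ∃ (K : C5.SmallLevel C.S.K₀) (φ : C.etaleH1 ℓ K), C.toTower ℓ K φ = x := by
  haveI := RestOne.isDirectedOrder_idx C
  haveI := RestOne.nonempty_idx C
  obtain ⟨i, φ, hφ⟩ := Module.DirectLimit.exists_of (R := ℚ_[ℓ]) (ι := Idx C) (G := C.etSysObj ℓ) (f := C.etSys ℓ) x
  exact ⟨OrderDual.ofDual i, φ, hφ⟩

/-- **`[·]_K : H¹_ét(A_K) → H¹_ét(A_∞)` is injective** at every level, granted that every pull-back `ᵗV_ℓ(Alb_{u^{K'}_K})` is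
injective (a directed colimit with injective transition maps; the étale twin of `Sec42Data.resOf_injective`).
[cite: Liu2021, Thm. 4.18 (1) (FJcycle.tex l. 2239) and §4.3 (l. 2158)] -/
theorem toTower_injective
    (hI : ∀ ⦃K K' : C5.SmallLevel C.S.K₀⦄ (f : K' ⟶ K),
      Function.Injective (rationalTateModuleMap ℓ (C.Atr f)).dualMap)
    (K : C5.SmallLevel C.S.K₀) : Function.Injective (C.toTower ℓ K) := by
  haveI := RestOne.isDirectedOrder_idx C
  haveI := C.directedSystem_etSys ℓ
  refine (injective_iff_map_eq_zero (C.toTower ℓ K)).2 fun φ hφ => ?_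
  obtain ⟨j, hij, hj⟩ := Module.DirectLimit.of.zero_exact
    (R := ℚ_[ℓ]) (ι := Idx C) (G := C.etSysObj ℓ) (f := C.etSys ℓ) (i := OrderDual.toDual K) (x := φ) hφ
  have hle : OrderDual.ofDual j ≤ K := hij
  have hj' : (rationalTateModuleMap ℓ (C.Atr (homOfLE hle))).dualMap φ = 0 := hj
  exact hI (homOfLE hle) (a₁ := φ) (a₂ := 0) (by rw [hj', map_zero])

end Sec42Data

/-! ## §2 The Hecke action on `H¹_ét(A_∞)` induced by the translates (étale twin of `RestOneHecke`) -/

namespace Sec42Data.HeckeTranslates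

variable {C : Sec42Data P5 isotropicAt} (T : C.HeckeTranslates) (ℓ : ℕ) [Fact ℓ.Prime]

open RestOne (Idx)
open scoped Classical

/-- Level-`K` component of the action of `g` on `H¹_ét(A_∞)`: `φ ↦ [ᵗV_ℓ(Alb(T_g)) φ]_{gKg⁻¹ ∩ K₀}` for
`T_g : X_{gKg⁻¹ ∩ K₀} → X_K` (pull-back along `Alb(T_g)`, read on `(V_ℓ)^∨`; cf. `RestOneHecke.heckeAux`).
[cite: Liu2021, §4.2 l. 2074 and §4.3 l. 2160] -/
def etHeckeAux (g : C.G) (K : C5.SmallLevel C.S.K₀) : C.etaleH1 ℓ K →ₗ[ℚ_[ℓ]] C.etaleH1Tower ℓ :=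
  C.toTower ℓ (C5.heckeLevel g K) ∘ₗ
    (rationalTateModuleMap ℓ (T.albTr g (C5.heckeLevel g K) K (C5.heckeLE_heckeLevel g K))).dualMap

/-- Unfolding of `etHeckeAux`. Ours. [cite: Liu2021, §4.3 l. 2160] -/
theorem etHeckeAux_apply (g : C.G) (K : C5.SmallLevel C.S.K₀) (φ : C.etaleH1 ℓ K) :
    T.etHeckeAux ℓ g K φ = C.toTower ℓ (C5.heckeLevel g K)
      ((rationalTateModuleMap ℓ (T.albTr g (C5.heckeLevel g K) K (C5.heckeLE_heckeLevel g K))).dualMap φ) :=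
  rfl

/-- **Independence of the source level**: for ANY admissible `L` (`g⁻¹Lg ⊆ K`), `[ᵗV_ℓ(Alb(T_g : X_L → X_K)) φ]_L` is the same class
(it factors through the conjugate level by `Alb_u`, and `[·]_L ∘ ᵗV_ℓ(Alb_u) = [·]`).  Ours; cf. `RestOneHecke.of_pre_albTr`.
[cite: Liu2021, §4.2 l. 2070–2074 and §4.3 l. 2160] -/
theorem toTower_dualMap_albTr (g : C.G) {L K : C5.SmallLevel C.S.K₀} (h : C5.HeckeLE g L K) (φ : C.etaleH1 ℓ K) :
    C.toTower ℓ L ((rationalTateModuleMap ℓ (T.albTr g L K h)).dualMap φ) = T.etHeckeAux ℓ g K φ := by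
  have hle : L ≤ C5.heckeLevel g K := C5.le_heckeLevel_of_heckeLE h
  have e : T.albTr g L K h =
      C.Atr (homOfLE hle) ≫ T.albTr g (C5.heckeLevel g K) K (C5.heckeLE_heckeLevel g K) :=
    (T.Atr_comp_albTr (homOfLE hle) _).symm
  rw [etHeckeAux_apply, e, rationalTateModuleMap_comp, ← LinearMap.dualMap_comp_dualMap, LinearMap.comp_apply,
    C.toTower_pull ℓ (homOfLE hle)]

/-- The level components are compatible with the transition maps `ᵗV_ℓ(Alb_u)` (so they descend to the colimit).  Ours; cf.
`RestOneHecke.heckeAux_sys`. [cite: Liu2021, §4.2 l. 2070–2074 and §4.3 l. 2160] -/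
theorem etHeckeAux_sys (g : C.G) (i j : Idx C) (hij : i ≤ j) (φ : C.etSysObj ℓ i) :
    T.etHeckeAux ℓ g (OrderDual.ofDual j) (C.etSys ℓ i j hij φ) = T.etHeckeAux ℓ g (OrderDual.ofDual i) φ := by
  have hle : OrderDual.ofDual j ≤ OrderDual.ofDual i := hij
  show C.toTower ℓ (C5.heckeLevel g (OrderDual.ofDual j))
      ((rationalTateModuleMap ℓ (T.albTr g (C5.heckeLevel g (OrderDual.ofDual j)) (OrderDual.ofDual j)
        (C5.heckeLE_heckeLevel g (OrderDual.ofDual j)))).dualMap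
        ((rationalTateModuleMap ℓ (C.Atr (homOfLE hle))).dualMap φ)) = _
  rw [dualMap_rationalTateModuleMap_comp_apply, T.albTr_comp_Atr]
  exact T.toTower_dualMap_albTr ℓ g _ φ

/-- **The action of `g ∈ 𝔾(𝔸_F^∞)` on `H¹_ét(A_∞ ⊗_E Ē, ℚ_ℓ) = colim_K (V_ℓ A_K)^∨`**, `ℚ_ℓ`-linear: the map out of the colimit with
level components `etHeckeAux` (cf. `RestOneHecke.hecke`). [cite: Liu2021, §4.2 l. 2074 and §4.3 l. 2160] -/
def etHecke (g : C.G) : C.etaleH1Tower ℓ →ₗ[ℚ_[ℓ]] C.etaleH1Tower ℓ :=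
  Module.DirectLimit.lift ℚ_[ℓ] (Idx C) (C.etSysObj ℓ) (C.etSys ℓ) (fun i => T.etHeckeAux ℓ g (OrderDual.ofDual i))
    fun i j hij φ => T.etHeckeAux_sys ℓ g i j hij φ

/-- On a level class the action is the level component. Ours. [cite: Liu2021, §4.3 l. 2160] -/
theorem etHecke_of (g : C.G) (K : C5.SmallLevel C.S.K₀) (φ : C.etaleH1 ℓ K) :
    T.etHecke ℓ g (Module.DirectLimit.of ℚ_[ℓ] (Idx C) (C.etSysObj ℓ) (C.etSys ℓ) (OrderDual.toDual K) φ) =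
      T.etHeckeAux ℓ g K φ :=
  Module.DirectLimit.lift_of _ _ _

/-- **Defining formula**: `g · [φ]_K = [ᵗV_ℓ(Alb(T_g : X_L → X_K)) φ]_L` for every admissible source level `L` (`g⁻¹Lg ⊆ K`) — the
shape of `EtaleHeckeDatum.IsInducedBy`. [cite: Liu2021, §4.2 l. 2074 and §4.3 l. 2160] -/
theorem etHecke_toTower (g : C.G) {L K : C5.SmallLevel C.S.K₀} (h : C5.HeckeLE g L K) (φ : C.etaleH1 ℓ K) :
    T.etHecke ℓ g (C.toTower ℓ K φ) = C.toTower ℓ L ((rationalTateModuleMap ℓ (T.albTr g L K h)).dualMap φ) := by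
  show T.etHecke ℓ g (Module.DirectLimit.of ℚ_[ℓ] (Idx C) (C.etSysObj ℓ) (C.etSys ℓ) (OrderDual.toDual K) φ) = _
  rw [etHecke_of, T.toTower_dualMap_albTr]

/-- **The level `K` fixes the image of `[·]_K`**: `k · [φ]_K = [φ]_K` for `k ∈ K` (`Alb(T_k) = 𝟙`).
[cite: Liu2021, Thm. 4.18 (1) l. 2239 and §4.2 l. 2074] [cite: Milne2005ShimuraVarieties, §5 p. 57 L7–12] -/
theorem etHecke_toTower_of_mem {K : C5.SmallLevel C.S.K₀} {k : C.G} (hk : k ∈ K.1.1) (φ : C.etaleH1 ℓ K) :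
    T.etHecke ℓ k (C.toTower ℓ K φ) = C.toTower ℓ K φ := by
  rw [T.etHecke_toTower ℓ k (C5.HeckeLE.of_mem hk) φ, T.albTr_self hk, rationalTateModuleMap_id, LinearMap.dualMap_id,
    LinearMap.id_apply]

/-- `1` acts as the identity (`Alb(T_1) = Alb_u` and `[·]_L ∘ ᵗV_ℓ(Alb_u) = [·]_K`). [cite: Liu2021, §4.3 l. 2160]
[cite: Milne2005ShimuraVarieties, §5 p. 58 L3–6] -/
theorem etHecke_one : T.etHecke ℓ 1 = LinearMap.id := by
  refine Module.DirectLimit.hom_ext fun i => LinearMap.ext fun φ => ?_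
  rw [LinearMap.comp_apply, LinearMap.comp_apply, LinearMap.id_apply]
  show T.etHecke ℓ 1 (C.toTower ℓ (OrderDual.ofDual i) φ) = C.toTower ℓ (OrderDual.ofDual i) φ
  rw [T.etHecke_toTower ℓ 1 (C5.HeckeLE.one_of_le le_rfl) φ,
    T.albTr_one (homOfLE (le_refl (OrderDual.ofDual i)))]
  have hid : (homOfLE (le_refl (OrderDual.ofDual i)) : OrderDual.ofDual i ⟶ OrderDual.ofDual i) = 𝟙 _ := rfl
  rw [hid, C.Atr_id, rationalTateModuleMap_id, LinearMap.dualMap_id, LinearMap.id_apply]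

/-- `gg'` acts as `g` after `g'` — a LEFT action: `ᵗV_ℓ(Alb T_g) (ᵗV_ℓ(Alb T_{g'}) φ) = ᵗV_ℓ(Alb(T_g ≫ T_{g'})) φ = ᵗV_ℓ(Alb T_{gg'}) φ`.
[cite: Liu2021, §4.2 l. 2074 and §4.3 l. 2160] [cite: Milne2005ShimuraVarieties, §5 p. 58 L6–11] -/
theorem etHecke_mul (g g' : C.G) : T.etHecke ℓ (g * g') = T.etHecke ℓ g ∘ₗ T.etHecke ℓ g' := by
  refine Module.DirectLimit.hom_ext fun i => LinearMap.ext fun φ => ?_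
  rw [LinearMap.comp_apply, LinearMap.comp_apply, LinearMap.comp_apply]
  show T.etHecke ℓ (g * g') (C.toTower ℓ (OrderDual.ofDual i) φ) =
    T.etHecke ℓ g (T.etHecke ℓ g' (C.toTower ℓ (OrderDual.ofDual i) φ))
  rw [T.etHecke_toTower ℓ g' (C5.heckeLE_heckeLevel g' (OrderDual.ofDual i)) φ,
    T.etHecke_toTower ℓ g (C5.heckeLE_heckeLevel g (C5.heckeLevel g' (OrderDual.ofDual i))),
    dualMap_rationalTateModuleMap_comp_apply, T.albTr_mul]
  exact T.etHecke_toTower ℓ (g * g') _ φ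

/-- **«a `ℚ_ℓ^{ac}[… × 𝔾(𝔸_F^∞)]`-module» (l. 2160): the Hecke action on `H¹_ét(A_∞ ⊗_E Ē, ℚ_ℓ)` as a REPRESENTATION** of
`𝔾(𝔸_F^∞) = C.G`, CONSTRUCTED from the Hecke translates (the `rhoEt` that `EtaleH1Tower.EtaleHeckeDatum` posits; cf.
`RestOneHecke.heckeRep`). [cite: Liu2021, §4.2 l. 2074 and §4.3 l. 2160] -/
def etHeckeRep : Representation ℚ_[ℓ] C.G (C.etaleH1Tower ℓ) where
  toFun := T.etHecke ℓ
  map_one' := T.etHecke_one ℓ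
  map_mul' g g' := T.etHecke_mul ℓ g g'

/-- `etHeckeRep g = etHecke g` (by `rfl`). [cite: Liu2021, §4.3 l. 2160] -/
theorem etHeckeRep_apply (g : C.G) : T.etHeckeRep ℓ g = T.etHecke ℓ g := rfl

/-- **Defining formula of the representation** (= `EtaleHeckeDatum.IsInducedBy T`): `g · [φ]_K = [ᵗV_ℓ(Alb T_g) φ]_L` for any admissible
`L` (`g⁻¹Lg ⊆ K`). [cite: Liu2021, §4.2 l. 2074 and §4.3 l. 2160] -/
theorem etHeckeRep_toTower (g : C.G) {L K : C5.SmallLevel C.S.K₀} (h : C5.HeckeLE g L K) (φ : C.etaleH1 ℓ K) :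
    T.etHeckeRep ℓ g (C.toTower ℓ K φ) = C.toTower ℓ L ((rationalTateModuleMap ℓ (T.albTr g L K h)).dualMap φ) :=
  T.etHecke_toTower ℓ g h φ

/-- `[·]_K` lands in the `K`-invariants: `k · [φ]_K = [φ]_K` for `k ∈ K`. [cite: Liu2021, Thm. 4.18 (1) l. 2239] -/
theorem etHeckeRep_toTower_of_mem {K : C5.SmallLevel C.S.K₀} {k : C.G} (hk : k ∈ K.1.1) (φ : C.etaleH1 ℓ K) :
    T.etHeckeRep ℓ k (C.toTower ℓ K φ) = C.toTower ℓ K φ :=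
  T.etHecke_toTower_of_mem ℓ hk φ

/-- **The induced Hecke action commutes with the Galois action** («`ℚ_ℓ^{ac}[Gal × 𝔾]`-module», l. 2160): the translates are defined
over `E`, so `V_ℓ(Alb T_g)` is `Γ_E`-equivariant (`rationalTateRep_rationalTateModuleMap`), dualised, in the colimit.
[cite: Liu2021, §4.3 (FJcycle.tex l. 2160)] -/
theorem etHeckeRep_towerRep (g : C.G) (σ : Field.absoluteGaloisGroup E) (x : C.etaleH1Tower ℓ) :
    T.etHeckeRep ℓ g (C.towerRep ℓ σ x) = C.towerRep ℓ σ (T.etHeckeRep ℓ g x) := by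
  obtain ⟨K, φ, rfl⟩ := C.exists_eq_toTower ℓ x
  rw [C.towerRep_toTower, T.etHeckeRep_toTower ℓ g (C5.heckeLE_heckeLevel g K),
    T.etHeckeRep_toTower ℓ g (C5.heckeLE_heckeLevel g K), C.towerRep_toTower]
  congr 1
  apply LinearMap.ext
  intro v
  rw [LinearMap.dualMap_apply, C.etaleH1Rep_apply, C.etaleH1Rep_apply, LinearMap.dualMap_apply,
    rationalTateRep_rationalTateModuleMap]

/-- **Smoothness**: every class of `H¹_ét(A_∞)` is fixed by some sufficiently small level (it is a level class, fixed by its level).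
[cite: Liu2021, §4.2 l. 2081 («admissible») and Thm. 4.18 (1) l. 2239] -/
theorem exists_forall_etHeckeRep_eq (x : C.etaleH1Tower ℓ) :
    ∃ K : C5.SmallLevel C.S.K₀, ∀ k ∈ K.1.1, T.etHeckeRep ℓ k x = x := by
  obtain ⟨K, φ, rfl⟩ := C.exists_eq_toTower ℓ x
  exact ⟨K, fun k hk => T.etHeckeRep_toTower_of_mem ℓ hk φ⟩

/-! ## §3 Level compatibility: descent of `K`-invariant forms from `IsogenyDescent` (the norm endomorphism) -/

/-- **Descent of invariant linear forms, from descent up to isogeny.**  For small levels `N ⊆ K` with `N` normalised by `K` and a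
linear form `λ` on `V_ℓ(A_N)` with `λ ∘ V_ℓ(Alb T_k) = λ` for all `k ∈ K`, `λ` is pulled back from `V_ℓ(A_K)` along `Alb_{u^N_K}`.
Proof: `K/N` is finite (`N` open in the compact `K`); the norm `e := Σ_{q ∈ K/N} Alb(T_q) ∈ End(A_N)` is `K`-invariant
(`Alb T_k ≫ Alb T_q = Alb T_{kq}`, `Alb T_n = 𝟙` for `n ∈ N`), so `IsogenyDescent` gives `Alb_u ≫ ψ = m • e` with `m ≠ 0`; then
`λ ∘ V_ℓ ψ ∘ V_ℓ Alb_u = m • λ ∘ V_ℓ e = m·[K:N] • λ`. [cite: Liu2021, Thm. 4.18 (1) (FJcycle.tex l. 2239, l. 2274–2282) and Lem. 2.4 (1)] -/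
theorem exists_dualMap_eq_of_isogenyDescent (hD : T.IsogenyDescent) {N K : C5.SmallLevel C.S.K₀} (hNK : N ≤ K)
    (hn : ∀ k ∈ K.1.1, C5.HeckeLE k N N) (lam : C.etaleH1 ℓ N)
    (hinv : ∀ (k : C.G) (hk : k ∈ K.1.1), (rationalTateModuleMap ℓ (T.albTr k N N (hn k hk))).dualMap lam = lam) :
    ∃ μ : C.etaleH1 ℓ K, (rationalTateModuleMap ℓ (C.Atr (homOfLE hNK))).dualMap μ = lam := by
  -- the finite quotient `K / N`
  haveI : CompactSpace K.1.1 := isCompact_iff_compactSpace.1 K.1.2.2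
  let N' : Subgroup K.1.1 := N.1.1.subgroupOf K.1.1
  haveI : Finite (K.1.1 ⧸ N') :=
    Subgroup.quotient_finite_of_isOpen N' (N.1.2.1.preimage continuous_subtype_val)
  letI : Fintype (K.1.1 ⧸ N') := Fintype.ofFinite _
  -- the translates as a function on `K / N`
  let a : K.1.1 ⧸ N' → (C.A N ⟶ C.A N) := fun q => T.albTr (q.out : C.G) N N (hn _ q.out.2)
  have ha : ∀ (k : C.G) (hk : k ∈ K.1.1),
      T.albTr k N N (hn k hk) = a (QuotientGroup.mk (⟨k, hk⟩ : K.1.1)) := by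
    intro k hk
    obtain ⟨n, hkn⟩ := QuotientGroup.mk_out_eq_mul N' (⟨k, hk⟩ : K.1.1)
    have hnN : ((n : K.1.1) : C.G) ∈ N.1.1 := Subgroup.mem_subgroupOf.1 n.2
    have e1 : a (QuotientGroup.mk (⟨k, hk⟩ : K.1.1)) =
        T.albTr (k * ((n : K.1.1) : C.G)) N N ((hn k hk).mul (C5.HeckeLE.of_mem hnN)) :=
      T.albTr_congr (congrArg Subtype.val hkn) _ _
    rw [e1, ← T.albTr_mul k _ (hn k hk) (C5.HeckeLE.of_mem hnN), T.albTr_self hnN, Category.comp_id]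
  have hka : ∀ (k : C.G) (hk : k ∈ K.1.1) (q : K.1.1 ⧸ N'),
      T.albTr k N N (hn k hk) ≫ a q = a ((⟨k, hk⟩ : K.1.1) • q) := by
    intro k hk q
    have e1 : T.albTr k N N (hn k hk) ≫ a q =
        T.albTr (k * (q.out : C.G)) N N (hn _ ((⟨k, hk⟩ : K.1.1) * q.out).2) :=
      (T.albTr_mul _ _ _ _).trans (T.albTr_congr rfl _ _)
    rw [e1, ha (k * (q.out : C.G)) ((⟨k, hk⟩ : K.1.1) * q.out).2, ← MulAction.Quotient.mk_smul_out N' (⟨k, hk⟩ : K.1.1) q]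
    rfl
  -- the norm endomorphism and its invariance
  let e : C.A N ⟶ C.A N := ∑ q, a q
  have he : ∀ (k : C.G) (hk : k ∈ K.1.1), T.albTr k N N (hn k hk) ≫ e = e := by
    intro k hk
    show T.albTr k N N (hn k hk) ≫ ∑ q, a q = ∑ q, a q
    rw [Preadditive.comp_sum]
    exact (Finset.sum_congr rfl fun q _ => hka k hk q).trans
      (Equiv.sum_comp (MulAction.toPerm (⟨k, hk⟩ : K.1.1)) a)
  obtain ⟨m, ψ, hm, hψ⟩ := hD hNK hn (C.A N) e he
  -- `V_ℓ` is additive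
  let Vh : (C.A N ⟶ C.A N) →+ ((C.A N).rationalTateModule ℓ →ₗ[ℚ_[ℓ]] (C.A N).rationalTateModule ℓ) :=
    AddMonoidHom.mk' (fun f => rationalTateModuleMap ℓ f) (rationalTateModuleMap_add ℓ)
  have hVe : ∀ v, lam (rationalTateModuleMap ℓ e v) = (Fintype.card (K.1.1 ⧸ N') : ℚ_[ℓ]) * lam v := by
    intro v
    have h1 : rationalTateModuleMap ℓ e = ∑ q, rationalTateModuleMap ℓ (a q) := map_sum Vh a Finset.univ
    rw [h1, LinearMap.sum_apply, map_sum]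
    have h2 : ∀ q, lam (rationalTateModuleMap ℓ (a q) v) = lam v := by
      intro q
      have := hinv (q.out : C.G) q.out.2
      exact LinearMap.congr_fun this v
    simp_rw [h2]
    rw [Finset.sum_const, Finset.card_univ, nsmul_eq_mul]
  have hVψ : (rationalTateModuleMap ℓ ψ) ∘ₗ rationalTateModuleMap ℓ (C.Atr (homOfLE hNK)) = m • rationalTateModuleMap ℓ e := by
    rw [← rationalTateModuleMap_comp, hψ]
    exact map_zsmul Vh m e
  have hm' : (m : ℚ_[ℓ]) ≠ 0 := Int.cast_ne_zero.2 hm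
  have hc : (Fintype.card (K.1.1 ⧸ N') : ℚ_[ℓ]) ≠ 0 := Nat.cast_ne_zero.2 Fintype.card_ne_zero
  refine ⟨((m : ℚ_[ℓ]) * Fintype.card (K.1.1 ⧸ N'))⁻¹ • (rationalTateModuleMap ℓ ψ).dualMap lam, ?_⟩
  apply LinearMap.ext
  intro v
  rw [map_smul, LinearMap.smul_apply, LinearMap.dualMap_apply, LinearMap.dualMap_apply,
    ← LinearMap.comp_apply (f := rationalTateModuleMap ℓ ψ) (g := rationalTateModuleMap ℓ (C.Atr (homOfLE hNK))), hVψ,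
    LinearMap.smul_apply, map_zsmul, hVe, zsmul_eq_mul, smul_eq_mul]
  field_simp

/-- **`range [·]_K = H¹_ét(A_∞)^K` at EVERY sufficiently small level**, for the induced Hecke action, granted injective étale pull-backs
and `T.IsogenyDescent`.  Proof (cf. `RestOneLevelInvariants.range_resOf_eq`): a class lives at some level; refine to a level `N ⊆ K`
normalised by `K` (compactness); invariance in the colimit is invariance at level `N` by injectivity; descend to `K` by
`exists_dualMap_eq_of_isogenyDescent`. [cite: Liu2021, Thm. 4.18 (1) (FJcycle.tex l. 2239) and §4.3 (l. 2158–2160)] -/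
theorem range_toTower_eq_of_isogenyDescent
    (hI : ∀ ⦃K K' : C5.SmallLevel C.S.K₀⦄ (f : K' ⟶ K),
      Function.Injective (rationalTateModuleMap ℓ (C.Atr f)).dualMap)
    (hD : T.IsogenyDescent) (K : C5.SmallLevel C.S.K₀) :
    Set.range (C.toTower ℓ K) = {x | ∀ k ∈ K.1.1, T.etHeckeRep ℓ k x = x} := by
  ext x
  constructor
  · rintro ⟨φ, rfl⟩ k hk
    exact T.etHeckeRep_toTower_of_mem ℓ hk φ
  · intro hx
    obtain ⟨K₁, φ₀, hφ₀⟩ := C.exists_eq_toTower ℓ x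
    obtain ⟨N, hNK, hNK₁, hN⟩ := C5.SmallLevel.exists_normal_le K K₁
    -- move the representative to the level `N`
    set φ : C.etaleH1 ℓ N := (rationalTateModuleMap ℓ (C.Atr (homOfLE hNK₁))).dualMap φ₀ with hφ
    have hxφ : C.toTower ℓ N φ = x := by
      rw [← hφ₀, hφ]
      exact C.toTower_pull ℓ (homOfLE hNK₁) φ₀
    -- invariance at level `N`
    have hinv : ∀ (k : C.G) (hk : k ∈ K.1.1), (rationalTateModuleMap ℓ (T.albTr k N N (hN k hk))).dualMap φ = φ := by
      intro k hk
      apply C.toTower_injective ℓ hI N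
      rw [← T.etHeckeRep_toTower ℓ k (hN k hk) φ, hxφ]
      exact hx k hk
    obtain ⟨μ, hμ⟩ := T.exists_dualMap_eq_of_isogenyDescent ℓ hD hNK hN φ hinv
    refine ⟨μ, ?_⟩
    rw [← hxφ, ← hμ]
    exact (C.toTower_pull ℓ (homOfLE hNK) μ).symm

/-! ## §4 The étale Hecke datum of `EtaleH1Tower.lean`, INHABITED from the translates -/

/-- **The étale Hecke datum induced by the translates** — the POSITED structure `C.EtaleHeckeDatum ℓ` of `EtaleH1Tower.lean` CONSTRUCTED:
`rhoEt := etHeckeRep` (the action «provided by the Hecke correspondences», l. 2074/2160), `comm` (`etHeckeRep_towerRep`), `smooth`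
(`exists_forall_etHeckeRep_eq`), and `levelCompat` at EVERY level below `K₀` (`toTower_injective`, `range_toTower_eq_of_isogenyDescent`),
granted injective étale pull-backs `hI` and descent up to isogeny `hD` (row (D)). [cite: Liu2021, §4.3 (FJcycle.tex l. 2154–2160) and Thm. 4.18 (1) l. 2239] -/
def etaleHeckeDatumOfTranslates
    (hI : ∀ ⦃K K' : C5.SmallLevel C.S.K₀⦄ (f : K' ⟶ K),
      Function.Injective (rationalTateModuleMap ℓ (C.Atr f)).dualMap)
    (hD : T.IsogenyDescent) : C.EtaleHeckeDatum ℓ where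
  rhoEt := T.etHeckeRep ℓ
  comm g σ x := T.etHeckeRep_towerRep ℓ g σ x
  smooth x := T.exists_forall_etHeckeRep_eq ℓ x
  levelCompat := ⟨⟨C.S.K₀, le_rfl⟩, fun K _ =>
    ⟨C.toTower_injective ℓ hI K, T.range_toTower_eq_of_isogenyDescent ℓ hI hD K⟩⟩

/-- The Hecke action of the constructed datum is `etHeckeRep` (by `rfl`). [cite: Liu2021, §4.3 l. 2160] -/
theorem rhoEt_etaleHeckeDatumOfTranslates
    (hI : ∀ ⦃K K' : C5.SmallLevel C.S.K₀⦄ (f : K' ⟶ K),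
      Function.Injective (rationalTateModuleMap ℓ (C.Atr f)).dualMap)
    (hD : T.IsogenyDescent) : (T.etaleHeckeDatumOfTranslates ℓ hI hD).rhoEt = T.etHeckeRep ℓ :=
  rfl

/-- **The constructed datum IS induced by `T`** (`EtaleHeckeDatum.IsInducedBy`, the pin of `EtaleBettiComparison.lean` §1).
[cite: Liu2021, §4.2 l. 2074 and §4.3 l. 2160] -/
theorem isInducedBy_etaleHeckeDatumOfTranslates
    (hI : ∀ ⦃K K' : C5.SmallLevel C.S.K₀⦄ (f : K' ⟶ K),
      Function.Injective (rationalTateModuleMap ℓ (C.Atr f)).dualMap)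
    (hD : T.IsogenyDescent) : (T.etaleHeckeDatumOfTranslates ℓ hI hD).IsInducedBy T :=
  fun g _ _ h x => T.etHeckeRep_toTower ℓ g h x

end Sec42Data.HeckeTranslates

end Literature.NumberTheory.Automorphic.Liu2021.AppendixC

end
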